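import Summits.MatrixMultiplication.MatrixMultiplication.Theorems.LevelOneGL2Designs.Negative.WindowP3
import Summits.MatrixMultiplication.MatrixMultiplication.Theorems.LevelOneGL2Designs.Negative.SharpCells

/-!
# Crux `LevelOneGL2Designs` (stmt-MatrixMultiplication-14080), certified-compute lane:
the `p = 3` window, BOTH SIDES in one statement

Certified-compute seat (`refuter-ccert-…-14080-0`); no theorem asserts a Theses statement
positively.  Packaging of the landed pieces at `p = 3` (`W(3) = dim F_1|_{GL_2(𝔽_3)} = 26`,
`DimensionP3.lean`):

* `balanced_window_at_three` — `M(3) = 3`: a rank-1-separated triple with all three sets of size `3`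
  exists (`WindowP3.exists_balanced_three_at_three`, explicit, `native_decide` via the checker) and NO
  rank-1-separated triple has all three sets of size `≥ 4` (`SharpWall.min_card_le_three_at_three`,
  the sharp graded Neumann count `2t² − t ≤ 26`).  So at `p = 3` the crux's normalised size
  `min(|X|,|Y|,|Z|)/p^{3/2}` is exactly `3/3^{3/2} = 1/√3 ≈ 0.577` (the crux asks for `≥ c` along a sequence
  of primes; its constant window is `c ≤ 1/√2`).
* `volume_window_at_three` — a rank-1-separated triple of volume `36` exists (`(3,2,6)`,
  `WindowP3.exists_profile_3_2_6_at_3`; the exhaustive census [compute j019016] shows `36` is the maximum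
  over proper triples) and EVERY rank-1-separated triple has volume `≤ 60 < 92 = B₃(3)`
  (`SharpCells.volume_le_at_three`): the exponent-3 cell is empty with room, `36/26 = 1.38·W`.
-/

namespace Summit.MatrixMultiplication.MatrixMultiplication.Theorems.LevelOneGL2Designs.Negative

open Summit.MatrixMultiplication.MatrixMultiplication.Theorems.LieRankDesigns.Negative

/-- **The balanced window at `p = 3` is exactly `3`**: some rank-1-separated triple of `GL_2(𝔽_3)`
has `|X| = |Y| = |Z| = 3`, and every rank-1-separated triple has `min(|X|,|Y|,|Z|) ≤ 3`. -/
theorem balanced_window_at_three [Fact (Nat.Prime 3)] :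
    (∃ X Y Z : Finset (GLm 3 2), RankSep 1 X Y Z ∧ X.card = 3 ∧ Y.card = 3 ∧ Z.card = 3) ∧
    (∀ (X Y Z : Finset (GLm 3 2)) (t : ℕ), RankSep 1 X Y Z →
      t ≤ X.card → t ≤ Y.card → t ≤ Z.card → t ≤ 3) :=
  ⟨exists_balanced_three_at_three,
    fun _ _ _ _ hsep hX hY hZ => min_card_le_three_at_three hsep hX hY hZ⟩

/-- **The volume window at `p = 3`**: some rank-1-separated triple of `GL_2(𝔽_3)` has volume `36`
(profile `(3,2,6)`), and every rank-1-separated triple has volume `≤ 60` (`< B₃(3) = 92`). -/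
theorem volume_window_at_three [Fact (Nat.Prime 3)] :
    (∃ X Y Z : Finset (GLm 3 2), RankSep 1 X Y Z ∧ X.card * Y.card * Z.card = 36) ∧
    (∀ X Y Z : Finset (GLm 3 2), RankSep 1 X Y Z → X.card * Y.card * Z.card ≤ 60) := by
  refine ⟨?_, fun X Y Z hsep => volume_le_at_three hsep⟩
  obtain ⟨X, Y, Z, hsep, hX, hY, hZ⟩ := exists_profile_3_2_6_at_3
  exact ⟨X, Y, Z, hsep, by rw [hX, hY, hZ]⟩

end Summit.MatrixMultiplication.MatrixMultiplication.Theorems.LevelOneGL2Designs.Negative
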